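import Mathlib

/-!
# Crux `ExactCertificate` (stmt-AtomisticToContinuum-11959), line `closure-makes-nogap-exact`,
# Transfer skeleton V (`OneCrossingChainCertificate`): stub `stub_classPsiPosType`

Support file for the crux `ThreeConeCertificate.ExactCertificate`, d = 1 transfer skeleton V
(`Cruxes.ExactCertificate.Transfer1D.OneCrossingChainCertificate`).  This file proves the
registered stub `stub_classPsiPosType`, the class form of `stub_psiPosTypeOf`
(file `…Transfer1DPsiPosType.lean`): for an abstract pair potential with Laplace representation
`V(r) = -∫₀^∞ e^{-tr} p(t) dt` (`r > 0`) and a spacing `a > 0`, the retarded Green's function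
`Ψ_a(y) := -4 Σ_{k ≥ 0} (k+1) · V(|y| + (k+1)a)` has non-negative Gram forms,
`0 ≤ Σ_{ij} w_i w_j Ψ_a(x_i - x_j)`, GIVEN

* antitonicity of `t ↦ Q(t)/t` on `(0,∞)` for every exponential Gram form
  `Q(t) = Σ_{ij} w_i w_j e^{-t|x_i - x_j|}` (the tree theorem `stub_quadAntitone`, a hypothesis here);
* the single-crossing conclusion at `a` (the neighbouring stub `stub_classCrossing`, a hypothesis
  here): `0 ≤ Σ_k (k+1) ∫₀^∞ e^{-t(k+1)a} p(t) (t h(t)) dt` for every antitone `h`.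

The proof rewrites the Gram form through the Laplace representation:
`∫₀^∞ e^{-tb} p(t) Q(t) dt = -Σ_{ij} w_i w_j V(|x_i - x_j| + b)` (`classPsi_integral_gram`, finite
sums commute with the integral), applies the crossing hypothesis with `h = Q/t`, and swaps the
finite sums with the `k`-series.  All `[folklore]`; no named facts are used.
-/

noncomputable section

namespace Summit.AtomisticToContinuum.Crystallization.Theorems.ThreeConeCertificateExactCertificate.Transfer1D

open MeasureTheory Set Filter Topology
open scoped BigOperators

/-- **The Gram form through the Laplace representation.**  If `e^{-tr} p(t)` is integrable on
`(0,∞)` and `V r = -∫₀^∞ e^{-tr} p(t) dt` for every `r > 0`, then for `b > 0` the integrand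
`e^{-tb} p(t) · (t · (Q(t)/t))`, `Q(t) = Σ_{ij} w_i w_j e^{-t|x_i - x_j|}`, is integrable on `(0,∞)`
and integrates to `-Σ_{ij} w_i w_j V(|x_i - x_j| + b)` (on `(0,∞)` it is the finite sum
`Σ_{ij} w_i w_j e^{-t(|x_i - x_j| + b)} p(t)`). [folklore] -/
theorem classPsi_integral_gram {V p : ℝ → ℝ}
    (hint : ∀ r : ℝ, 0 < r → IntegrableOn (fun t : ℝ => Real.exp (-(t * r)) * p t) (Set.Ioi 0))
    (hV : ∀ r : ℝ, 0 < r → V r = -(∫ t in Set.Ioi (0 : ℝ), Real.exp (-(t * r)) * p t))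
    {n : ℕ} (x w : Fin n → ℝ) {b : ℝ} (hb : 0 < b) :
    IntegrableOn (fun t : ℝ => Real.exp (-(t * b)) * p t
      * (t * ((∑ i, ∑ j, w i * w j * Real.exp (-(t * |x i - x j|))) / t))) (Set.Ioi 0) ∧
    ∫ t in Set.Ioi (0 : ℝ), Real.exp (-(t * b)) * p t
      * (t * ((∑ i, ∑ j, w i * w j * Real.exp (-(t * |x i - x j|))) / t))
      = -∑ i, ∑ j, w i * w j * V (|x i - x j| + b) := by
  -- on `(0,∞)` the integrand is the finite sum `G`
  set G : ℝ → ℝ := fun t => ∑ i, ∑ j, w i * w j *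
    (Real.exp (-(t * (|x i - x j| + b))) * p t) with hG
  have heq : EqOn G (fun t : ℝ => Real.exp (-(t * b)) * p t
      * (t * ((∑ i, ∑ j, w i * w j * Real.exp (-(t * |x i - x j|))) / t))) (Ioi 0) := by
    intro t ht
    have ht0 : t ≠ 0 := (mem_Ioi.1 ht).ne'
    simp only [hG]
    rw [mul_div_cancel₀ _ ht0, Finset.mul_sum]
    refine Finset.sum_congr rfl fun i _ => ?_
    rw [Finset.mul_sum]
    refine Finset.sum_congr rfl fun j _ => ?_
    rw [show -(t * (|x i - x j| + b)) = -(t * |x i - x j|) + -(t * b) by ring, Real.exp_add]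
    ring
  have hint' : ∀ i j : Fin n, Integrable (fun t : ℝ => w i * w j *
      (Real.exp (-(t * (|x i - x j| + b))) * p t)) (volume.restrict (Ioi 0)) := fun i j =>
    (hint _ (by positivity : 0 < |x i - x j| + b)).const_mul _
  have hGint : IntegrableOn G (Ioi 0) :=
    integrable_finsetSum _ fun i _ => integrable_finsetSum _ fun j _ => hint' i j
  refine ⟨hGint.congr_fun heq measurableSet_Ioi, ?_⟩
  rw [← setIntegral_congr_fun measurableSet_Ioi heq]
  simp only [hG]
  rw [integral_finsetSum _ fun i _ => integrable_finsetSum _ fun j _ => hint' i j,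
    ← Finset.sum_neg_distrib]
  refine Finset.sum_congr rfl fun i _ => ?_
  rw [integral_finsetSum _ fun j _ => hint' i j, ← Finset.sum_neg_distrib]
  refine Finset.sum_congr rfl fun j _ => ?_
  rw [integral_const_mul, hV _ (by positivity : 0 < |x i - x j| + b)]
  ring

/-- **`Ψ_a` is of positive type (class form).**  Given (i) antitonicity of `t ↦ Q(t)/t` on `(0,∞)`
for every exponential Gram form `Q` (the statement of `stub_quadAntitone`), an abstract pair
potential `V r = -∫₀^∞ e^{-tr} p(t) dt` (`r > 0`, integrable Laplace integrands), a spacing `a > 0`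
with summable chains `k ↦ (k+1) V(y + (k+1)a)` (`y ≥ 0`), and (ii) the single-crossing
conclusion at `a` (the statement of `stub_classCrossing` applied at `a`), the kernel
`Ψ_a(y) = -4 Σ_k (k+1) V(|y| + (k+1)a)` satisfies `0 ≤ Σ_{ij} w_i w_j Ψ_a(x_i - x_j)`.
[folklore] -/
theorem stub_classPsiPosType :
    (∀ (n : ℕ) (x : Fin n → ℝ) (w : Fin n → ℝ),
      AntitoneOn (fun t : ℝ => (∑ i, ∑ j, w i * w j * Real.exp (-(t * |x i - x j|))) / t)
        (Set.Ioi 0)) →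
    ∀ (V p : ℝ → ℝ) (a : ℝ), 0 < a →
    (∀ r : ℝ, 0 < r → IntegrableOn (fun t : ℝ => Real.exp (-(t * r)) * p t) (Set.Ioi 0)) →
    (∀ r : ℝ, 0 < r → V r = -(∫ t in Set.Ioi (0 : ℝ), Real.exp (-(t * r)) * p t)) →
    (∀ y : ℝ, 0 ≤ y → Summable (fun k : ℕ => ((k : ℝ) + 1) * V (y + ((k : ℝ) + 1) * a))) →
    (∀ h : ℝ → ℝ, AntitoneOn h (Set.Ioi 0) →
      (∀ k : ℕ, IntegrableOn
        (fun t : ℝ => Real.exp (-(t * (((k : ℝ) + 1) * a))) * p t * (t * h t)) (Set.Ioi 0)) →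
      Summable (fun k : ℕ => ((k : ℝ) + 1) *
        ∫ t in Set.Ioi (0 : ℝ), Real.exp (-(t * (((k : ℝ) + 1) * a))) * p t * (t * h t)) →
      0 ≤ ∑' k : ℕ, ((k : ℝ) + 1) *
        ∫ t in Set.Ioi (0 : ℝ), Real.exp (-(t * (((k : ℝ) + 1) * a))) * p t * (t * h t)) →
    ∀ (n : ℕ) (x : Fin n → ℝ) (w : Fin n → ℝ),
      0 ≤ ∑ i, ∑ j, w i * w j *
        (-4 * ∑' k : ℕ, ((k : ℝ) + 1) * V (|x i - x j| + ((k : ℝ) + 1) * a)) := by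
  intro hQA V p a ha hint hV hsumV hCR n x w
  -- the pair families are summable, and `b_k = (k+1) a > 0`
  have hsum : ∀ i j : Fin n, Summable (fun k : ℕ =>
      ((k : ℝ) + 1) * V (|x i - x j| + ((k : ℝ) + 1) * a)) :=
    fun i j => hsumV _ (abs_nonneg _)
  have hb : ∀ k : ℕ, (0 : ℝ) < ((k : ℝ) + 1) * a := fun k => by positivity
  have hG := fun k : ℕ => classPsi_integral_gram hint hV x w (hb k)
  -- each term of the crossing sum is a finite combination of the pair families
  have e : ∀ k : ℕ, ((k : ℝ) + 1) * ∫ t in Set.Ioi (0 : ℝ),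
      Real.exp (-(t * (((k : ℝ) + 1) * a))) * p t
      * (t * ((∑ i, ∑ j, w i * w j * Real.exp (-(t * |x i - x j|))) / t))
      = ∑ i, ∑ j, -(w i * w j) * (((k : ℝ) + 1) * V (|x i - x j| + ((k : ℝ) + 1) * a)) := by
    intro k
    rw [(hG k).2, mul_neg, Finset.mul_sum, ← Finset.sum_neg_distrib]
    refine Finset.sum_congr rfl fun i _ => ?_
    rw [Finset.mul_sum, ← Finset.sum_neg_distrib]
    refine Finset.sum_congr rfl fun j _ => ?_
    ring
  have hS : Summable (fun k : ℕ => ∑ i, ∑ j,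
      -(w i * w j) * (((k : ℝ) + 1) * V (|x i - x j| + ((k : ℝ) + 1) * a))) :=
    summable_sum fun i _ => summable_sum fun j _ => (hsum i j).mul_left _
  -- the crossing hypothesis with `h = Q / t`
  have key := hCR (fun t => (∑ i, ∑ j, w i * w j * Real.exp (-(t * |x i - x j|))) / t)
    (hQA n x w) (fun k => (hG k).1) (hS.congr fun k => (e k).symm)
  rw [tsum_congr e, Summable.tsum_finsetSum
    (fun i _ => summable_sum fun j _ => (hsum i j).mul_left _)] at key
  have ht : ∑ i, ∑' k : ℕ, ∑ j, -(w i * w j) * (((k : ℝ) + 1)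
      * V (|x i - x j| + ((k : ℝ) + 1) * a))
      = ∑ i, ∑ j, -(w i * w j) * ∑' k : ℕ, ((k : ℝ) + 1)
        * V (|x i - x j| + ((k : ℝ) + 1) * a) := by
    refine Finset.sum_congr rfl fun i _ => ?_
    rw [Summable.tsum_finsetSum (fun j _ => (hsum i j).mul_left _)]
    refine Finset.sum_congr rfl fun j _ => ?_
    exact tsum_mul_left
  rw [ht] at key
  have hgoal : ∑ i, ∑ j, w i * w j * (-4 * ∑' k : ℕ, ((k : ℝ) + 1)
      * V (|x i - x j| + ((k : ℝ) + 1) * a))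
      = 4 * ∑ i, ∑ j, -(w i * w j) * ∑' k : ℕ, ((k : ℝ) + 1)
        * V (|x i - x j| + ((k : ℝ) + 1) * a) := by
    rw [Finset.mul_sum]
    refine Finset.sum_congr rfl fun i _ => ?_
    rw [Finset.mul_sum]
    refine Finset.sum_congr rfl fun j _ => ?_
    ring
  rw [hgoal]
  exact mul_nonneg (by norm_num) key

end Summit.AtomisticToContinuum.Crystallization.Theorems.ThreeConeCertificateExactCertificate.Transfer1D

end
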